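import Literature.NumberTheory.LFunctions.PrimeIdealTheoremProofs
import Literature.NumberTheory.LFunctions.DedekindZetaHalfPlaneProofs
import Literature.NumberTheory.LFunctions.IdealCountProofs
import Literature.NumberTheory.LFunctions.DegreeOnePrimes
import Literature.NumberTheory.LFunctions.PrimeNumberTheoremErrorTerm
import Literature.NumberTheory.LFunctions.MertensSecondLogPower
import Mathlib.NumberTheory.Chebyshev
import Mathlib.NumberTheory.AbelSummation
import Mathlib.FieldTheory.Finite.Basic
import HarnessLib

/-!
# The prime number theorem for degree-one primes and for roots of polynomial congruences,
# with de la Vallée-Poussin error term, and the resulting Mertens theorems with rate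

Topic `Literature/NumberTheory/LFunctions` (next to `DegreeOnePrimes.lean`, `PrimeIdealPsi.lean`,
`PrimeIdealTheoremProofs.lean`). Everything in this file is PROVED (no named facts, no `sorry`).

Let `K` be a number field, `c_K(p) = #{𝔭 ⊂ 𝓞 K : N𝔭 = p}` the number of degree-one prime ideals
above the rational prime `p` (`Literature.idealNormCount K p`), and for `g ∈ ℤ[X]` monic irreducible let
`ν_g(p) = #{n mod p : g(n) ≡ 0 (mod p)}`. We prove

* `Literature.NumberTheory.LFunctions.NumberField.abs_degreeOneTheta_sub_self_le` — for every number field `K` there are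
  `c > 0`, `C` with `|∑_{p ≤ x} c_K(p) log p − x| ≤ C x exp(−c √log x)` for all `x ≥ 2`;
* `Literature.NumberTheory.LFunctions.DegreeOnePrimes.abs_sum_primesLE_rootCount_mul_log_sub_self_le` — for `g` monic
  irreducible, `|∑_{p ≤ x} ν_g(p) log p − x| ≤ C x exp(−c √log x)` (`x ≥ 2`);
* `Literature.NumberTheory.LFunctions.ThetaMertens.sum_primesLE_div_of_theta` — partial summation with rates: if
  `|∑_{p ≤ t} w(p) log p − λ t| ≤ C t/(log t)^{A+1}` for `t ≥ 2` then
  `∑_{p ≤ x} w(p)/p = λ log log x + c_w + O(1/(log x)^{A+1})` uniformly for `x ≥ 2`;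
* `Literature.NumberTheory.LFunctions.NumberField.sum_primesLE_idealNormCount_div_eq`,
  `Literature.NumberTheory.LFunctions.DegreeOnePrimes.sum_primesLE_rootCount_div_eq` — consequently, for every `A`,
  `∑_{p ≤ x} c_K(p)/p = log log x + c_K' + O_A((log x)^{-A})` and
  `∑_{p ≤ x} ν_g(p)/p = log log x + c_g + O_A((log x)^{-A})`.

These are the quantitative forms of "the degree-one primes have density one" behind the
convergence statements of `DegreeOnePrimes.lean` (there obtained Tauberian-wise, without error
terms). For `g = X² + 1` (`ν_g(p) = 1 + χ₄(p)` for odd `p`) the second item is the prime number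
theorem for the primes in the residue classes modulo `4` with de la Vallée-Poussin's error term,
obtained here through `ℚ(i)` rather than through `L(s, χ₄)`; it is consumed by
`Literature/NumberTheory/Sieve/FriedlanderIwaniecPrimesHyp27.lean` (hypothesis (2.7) of
Friedlander–Iwaniec's asymptotic sieve for the sequence `a² + b⁴`).

## The argument

All the analysis is already in the tree: the Weber–Landau ideal count
(`IdealCountProofs.lean`, `idealCount_sub_residue_mul_le_holds`) gives Landau's continuation of
`ζ_K` (`DedekindZetaHalfPlaneProofs.lean`), whence the zero-free region and
`|ψ_K(x) − x| ≤ C x e^{−c√log x}` (`ClassicalZeroFreeRegion.lean`, `ClassicalPsiErrorTerm.lean`,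
`PrimeIdealTheoremProofs.abs_chebyshevPsiIdeal_sub_le`; Montgomery–Vaughan Thm 8.9, Landau 1903)
and the same for `θ_K(x) = ∑_{N𝔭 ≤ x} log N𝔭` (`PrimeIdealPsi.chebyshevThetaIdeal_sub_self_le`).
What is added here is elementary:

1. `θ_K(x) − ∑_{p ≤ x} c_K(p) log p = ∑_{N𝔭 ≤ x, N𝔭 not prime} log N𝔭 ∈ [0, M_K √x (log x)^{d+2}]`:
   a prime ideal has prime-power norm (`isPrimePow_absNorm`, the order of its residue field), the
   prime ideals of norm `p` are exactly the ideals of norm `p` (`normPrimeIdealCount_prime`), there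
   are at most `c_K(p^k) ≤ (k+1)^d` prime ideals of norm `p^k` (`Literature.NumberTheory.LFunctions.idealNormCount_prime_pow_le`),
   and `∑_{p^k ≤ x, k ≥ 2} log p = ψ(x) − θ(x) ≤ 2 √x log x` (Mathlib `Chebyshev.psi_sub_theta_le`).
2. Dedekind–Kummer (`DegreeOnePrimes.exists_card_absNorm_eq_prime_eq_rootCount`): for
   `K = ℚ[X]/(g)`, `c_K(p) = ν_g(p)` for all `p ∤ e` (`e ≠ 0`), so the two Chebyshev functions
   differ by a bounded amount.
3. Abel summation with `f(t) = 1/(t log t)` (Mathlib `sum_mul_eq_sub_sub_integral_mul`), as in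
   Hardy–Wright §22.7 / the tree's `MertensConstant.primeRecipSum_eq_add_integral`: writing
   `θ_w(t) = λ t + E(t)`, the terms `λ/log x` cancel exactly and
   `∑_{p ≤ x} w(p)/p − λ log log x − c_w = E(x)/(x log x) + ∫_x^∞ E(t) (log t + 1) dt/(t² log² t)`,
   each `≪ 1/(log x)^{A+1}` by `∫_x^∞ dt/(t (log t)^{A+2}) = 1/((A+1)(log x)^{A+1})`
   (`Literature.NumberTheory.LFunctions.Mertens.integral_Ioi_inv_div_log_pow`, `MertensSecondLogPower.lean`, which treats `w = 1`).

## References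

* E. Landau, *Neuer Beweis des Primzahlsatzes und Beweis des Primidealsatzes*, Math. Ann. 56
  (1903), 645–670, §§12–13 (the passage `ψ_K ⇒ ϑ_K ⇒` prime ideals of degree one, p. 669).
  [cite: LandauMathAnn1903, §§12-13 p. 669]
* H. L. Montgomery, R. C. Vaughan, *Multiplicative Number Theory I. Classical Theory*, CUP 2007,
  Theorem 8.9 (prime ideal theorem), Theorem 2.7 (d) (Mertens by partial summation).
  [cite: MontgomeryVaughan2007, Thm 8.9 and Thm 2.7]
* G. H. Hardy, E. M. Wright, *An Introduction to the Theory of Numbers*, 6th ed., §22.7,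
  (22.7.3). [cite: HardyWright2008, §22.7]
-/

noncomputable section

open scoped NumberField
open Finset Real Filter MeasureTheory

namespace Literature.NumberTheory.LFunctions.NumberField

variable (K : Type*) [Field K] [NumberField K]

/-! ### Prime ideals have prime-power norm; `G(p) = c_K(p)` and `G(n) ≤ c_K(n)` -/

variable {K} in
/-- The absolute norm of a nonzero prime ideal of `𝓞 K` is a prime power (the order of the finite
residue field `𝓞 K / 𝔭`). [folklore] -/
theorem isPrimePow_absNorm {P : Ideal (𝓞 K)} (hP : P.IsPrime) (hP0 : P ≠ ⊥) :
    IsPrimePow (Ideal.absNorm P) := by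
  haveI : P.IsMaximal := hP.isMaximal hP0
  letI : Field (𝓞 K ⧸ P) := Ideal.Quotient.field P
  haveI : Finite (𝓞 K ⧸ P) :=
    (Ideal.absNorm_ne_zero_iff P).mp fun h => hP0 (Ideal.absNorm_eq_zero_iff.mp h)
  letI : Fintype (𝓞 K ⧸ P) := Fintype.ofFinite _
  rw [Ideal.absNorm_apply, Submodule.cardQuot_apply, Nat.card_eq_fintype_card]
  exact FiniteField.isPrimePow_card _

/-- `c_K(n)` as the cardinality of the set of ideals of norm `n`. [folklore] -/
theorem idealNormCount_eq_ncard (n : ℕ) :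
    idealNormCount K n = ({I : Ideal (𝓞 K) | Ideal.absNorm I = n}).ncard := by
  rw [idealNormCount, ← Nat.card_coe_set_eq]
  rfl

/-- `G(n) ≤ c_K(n)`: the prime ideals of norm `n` are among the ideals of norm `n`. [folklore] -/
theorem normPrimeIdealCount_le_idealNormCount (n : ℕ) :
    normPrimeIdealCount K n ≤ idealNormCount K n := by
  rw [idealNormCount_eq_ncard, normPrimeIdealCount]
  exact Set.ncard_le_ncard (fun P hP => hP.2.2) (Ideal.finite_setOf_absNorm_eq n)

/-- `G(p) = c_K(p)` for a rational prime `p`: an ideal of prime norm is a nonzero prime ideal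
(its norm is irreducible; Mathlib `Ideal.isPrime_of_irreducible_absNorm`), i.e. the prime ideals of
norm `p` are exactly the degree-one primes above `p`. [folklore] -/
theorem normPrimeIdealCount_prime {p : ℕ} (hp : p.Prime) :
    normPrimeIdealCount K p = idealNormCount K p := by
  rw [idealNormCount_eq_ncard, normPrimeIdealCount]
  congr 1
  ext I
  simp only [Set.mem_setOf_eq]
  constructor
  · rintro ⟨-, -, h⟩
    exact h
  · intro hI
    refine ⟨Ideal.isPrime_of_irreducible_absNorm ?_, fun h0 => hp.ne_zero ?_, hI⟩
    · rw [hI]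
      exact (Nat.irreducible_iff_nat_prime p).mpr hp
    · rw [← hI, h0]
      exact Ideal.absNorm_bot

/-- `G(n) = 0` unless `n` is a prime power. [folklore] -/
theorem normPrimeIdealCount_eq_zero_of_not_isPrimePow {n : ℕ} (hn : ¬ IsPrimePow n) :
    normPrimeIdealCount K n = 0 := by
  rw [normPrimeIdealCount, Set.ncard_eq_zero (finite_setOf_prime_absNorm_eq K n)]
  ext P
  simp only [Set.mem_setOf_eq, Set.mem_empty_iff_false, iff_false, not_and]
  intro hP hP0 h
  exact hn (h ▸ isPrimePow_absNorm hP hP0)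

/-! ### The Chebyshev function of the degree-one primes -/

/-- `θ_K^{(1)}(x) = ∑_{p ≤ x} c_K(p) log p`, the Chebyshev function of the rational primes weighted
by the number `c_K(p) = #{𝔭 : N𝔭 = p}` of degree-one prime ideals above them (equivalently, the
part of Landau's `ϑ_κ(x) = ∑_{N𝔭 ≤ x} log N𝔭` coming from the prime ideals of prime norm).
[cite: LandauMathAnn1903, §13 p. 669] -/
def degreeOneTheta (x : ℝ) : ℝ :=
  ∑ p ∈ Nat.primesLE ⌊x⌋₊, (idealNormCount K p : ℝ) * Real.log p

/-- `θ_K(x) − θ_K^{(1)}(x) = ∑_{n ≤ x, n not prime} G(n) log n` (the prime ideals of non-prime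
norm). [folklore] -/
theorem chebyshevThetaIdeal_sub_degreeOneTheta_eq (x : ℝ) :
    chebyshevThetaIdeal K x - degreeOneTheta K x =
      ∑ n ∈ (Icc 0 ⌊x⌋₊).filter (fun n => ¬ n.Prime),
        (normPrimeIdealCount K n : ℝ) * Real.log n := by
  rw [chebyshevThetaIdeal, degreeOneTheta, Nat.primesLE_eq_filter_Icc_zero,
    ← sum_filter_add_sum_filter_not (Icc 0 ⌊x⌋₊) (fun n => n.Prime)]
  have h : ∑ n ∈ (Icc 0 ⌊x⌋₊).filter Nat.Prime, (normPrimeIdealCount K n : ℝ) * Real.log n =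
      ∑ p ∈ (Icc 0 ⌊x⌋₊).filter Nat.Prime, (idealNormCount K p : ℝ) * Real.log p := by
    refine sum_congr rfl fun p hp => ?_
    rw [normPrimeIdealCount_prime K (mem_filter.mp hp).2]
  rw [h]
  ring

/-- `θ_K^{(1)} ≤ θ_K`. [folklore] -/
theorem degreeOneTheta_le_chebyshevThetaIdeal (x : ℝ) :
    degreeOneTheta K x ≤ chebyshevThetaIdeal K x := by
  have h := chebyshevThetaIdeal_sub_degreeOneTheta_eq K x
  have h0 : 0 ≤ ∑ n ∈ (Icc 0 ⌊x⌋₊).filter (fun n => ¬ n.Prime),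
      (normPrimeIdealCount K n : ℝ) * Real.log n :=
    sum_nonneg fun n _ => mul_nonneg (Nat.cast_nonneg _) (Real.log_natCast_nonneg n)
  linarith

/-- `θ_K^{(1)} ≥ 0`. [folklore] -/
theorem degreeOneTheta_nonneg (x : ℝ) : 0 ≤ degreeOneTheta K x :=
  sum_nonneg fun p _ => mul_nonneg (Nat.cast_nonneg _) (Real.log_natCast_nonneg p)

/-- Termwise: for `n ≤ x` not prime, `G(n) log n ≤ (log x/log 2 + 1)^d (log x/log 2) Λ(n)`
(`d = [K:ℚ]`): `G(n) = 0` unless `n = p^k` is a prime power, and then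
`G(n) ≤ c_K(p^k) ≤ (k+1)^d` (`Literature.NumberTheory.LFunctions.idealNormCount_prime_pow_le`), `k ≤ log x/log 2`,
`log n ≤ log x ≤ (log x/log 2) Λ(n)`. [folklore] -/
theorem normPrimeIdealCount_mul_log_le {x : ℝ} (hx : 1 ≤ x) {n : ℕ} (hn : (n : ℝ) ≤ x) :
    (normPrimeIdealCount K n : ℝ) * Real.log n ≤
      (Real.log x / Real.log 2 + 1) ^ Module.finrank ℚ K * (Real.log x / Real.log 2) *
        ArithmeticFunction.vonMangoldt n := by
  have hl2 : 0 < Real.log 2 := Real.log_pos one_lt_two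
  have hL : 0 ≤ Real.log x := Real.log_nonneg hx
  by_cases hpp : IsPrimePow n
  · set p := n.minFac with hpdef
    set k := n.factorization p with hkdef
    have hnpk : p ^ k = n := hpp.minFac_pow_factorization_eq
    have hp : p.Prime := Nat.minFac_prime hpp.ne_one
    have hk : k ≠ 0 := by
      intro hk0
      rw [hk0, pow_zero] at hnpk
      exact hpp.ne_one hnpk.symm
    have hΛ : ArithmeticFunction.vonMangoldt n = Real.log p := by
      rw [ArithmeticFunction.vonMangoldt_apply, if_pos hpp]
    have hn0 : (0 : ℝ) < n := by exact_mod_cast hpp.pos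
    have hp2 : (2 : ℝ) ≤ p := by exact_mod_cast hp.two_le
    have hlog2p : Real.log 2 ≤ Real.log p := Real.log_le_log two_pos hp2
    have hlogn : Real.log n = k * Real.log p := by
      rw [← hnpk, Nat.cast_pow, Real.log_pow]
    have hlognx : Real.log n ≤ Real.log x := Real.log_le_log hn0 hn
    have hG : (normPrimeIdealCount K n : ℝ) ≤ ((k : ℝ) + 1) ^ Module.finrank ℚ K := by
      calc (normPrimeIdealCount K n : ℝ) ≤ idealNormCount K n := by
            exact_mod_cast normPrimeIdealCount_le_idealNormCount K n
        _ = idealNormCount K (p ^ k) := by rw [hnpk]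
        _ ≤ ((k : ℝ) + 1) ^ Module.finrank ℚ K := idealNormCount_prime_pow_le K p k hp
    have hk_le : (k : ℝ) ≤ Real.log x / Real.log 2 := by
      rw [le_div_iff₀ hl2]
      have hk0 : (0 : ℝ) ≤ k := Nat.cast_nonneg _
      nlinarith
    have hlogn_le : Real.log n ≤ Real.log x / Real.log 2 * ArithmeticFunction.vonMangoldt n := by
      rw [hΛ]
      calc Real.log n ≤ Real.log x := hlognx
        _ = Real.log x / Real.log 2 * Real.log 2 := by field_simp
        _ ≤ Real.log x / Real.log 2 * Real.log p :=
            mul_le_mul_of_nonneg_left hlog2p (div_nonneg hL hl2.le)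
    calc (normPrimeIdealCount K n : ℝ) * Real.log n
        ≤ ((k : ℝ) + 1) ^ Module.finrank ℚ K * Real.log n :=
          mul_le_mul_of_nonneg_right hG (Real.log_natCast_nonneg n)
      _ ≤ (Real.log x / Real.log 2 + 1) ^ Module.finrank ℚ K *
            (Real.log x / Real.log 2 * ArithmeticFunction.vonMangoldt n) := by
          refine mul_le_mul (pow_le_pow_left₀ (by positivity) (by linarith) _) hlogn_le
            (Real.log_natCast_nonneg n) (by positivity)
      _ = _ := by ring
  · rw [normPrimeIdealCount_eq_zero_of_not_isPrimePow K hpp, Nat.cast_zero, zero_mul]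
    exact mul_nonneg (by positivity) ArithmeticFunction.vonMangoldt_nonneg

/-- **Prime ideals of non-prime norm are negligible**:
`0 ≤ θ_K(x) − θ_K^{(1)}(x) ≤ (log x/log 2 + 1)^d (log x/log 2) · 2 √x log x` for `x ≥ 1`, by the
termwise bound and Chebyshev's `ψ(x) − θ(x) ≤ 2 √x log x` (Mathlib `Chebyshev.psi_sub_theta_le`).
[folklore] -/
theorem chebyshevThetaIdeal_sub_degreeOneTheta_le {x : ℝ} (hx : 1 ≤ x) :
    chebyshevThetaIdeal K x - degreeOneTheta K x ≤
      (Real.log x / Real.log 2 + 1) ^ Module.finrank ℚ K * (Real.log x / Real.log 2) *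
        (2 * Real.sqrt x * Real.log x) := by
  have hx0 : 0 ≤ x := by linarith
  have hl2 : 0 < Real.log 2 := Real.log_pos one_lt_two
  have hL : 0 ≤ Real.log x := Real.log_nonneg hx
  set B : ℝ := (Real.log x / Real.log 2 + 1) ^ Module.finrank ℚ K * (Real.log x / Real.log 2)
    with hB
  have hB0 : 0 ≤ B := by positivity
  rw [chebyshevThetaIdeal_sub_degreeOneTheta_eq]
  have hsum : ∑ n ∈ (Icc 0 ⌊x⌋₊).filter (fun n => ¬ n.Prime), ArithmeticFunction.vonMangoldt n =
      ∑ n ∈ (Ioc 0 ⌊x⌋₊).filter (fun n => ¬ n.Prime), ArithmeticFunction.vonMangoldt n := by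
    rw [sum_filter, sum_filter, ← add_sum_Ioc_eq_sum_Icc (Nat.zero_le _)]
    simp
  calc ∑ n ∈ (Icc 0 ⌊x⌋₊).filter (fun n => ¬ n.Prime), (normPrimeIdealCount K n : ℝ) * Real.log n
      ≤ ∑ n ∈ (Icc 0 ⌊x⌋₊).filter (fun n => ¬ n.Prime), B * ArithmeticFunction.vonMangoldt n := by
        refine sum_le_sum fun n hn => ?_
        have hnx : (n : ℝ) ≤ x := by
          have h := (mem_Icc.mp (mem_filter.mp hn).1).2
          exact (Nat.cast_le.mpr h).trans (Nat.floor_le hx0)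
        exact normPrimeIdealCount_mul_log_le K hx hnx
    _ = B * (Chebyshev.psi x - Chebyshev.theta x) := by
        rw [← mul_sum, hsum, Chebyshev.psi_sub_theta_eq_sum_not_prime]
    _ ≤ B * (2 * Real.sqrt x * Real.log x) :=
        mul_le_mul_of_nonneg_left (Chebyshev.psi_sub_theta_le hx) hB0

/-- `√x (log x)^m ≤ (4m)^m e^{1/8} · x e^{−c √log x}` for `x ≥ 1`, `c ≤ 1/8`, `m ≥ 1`
(`L^m ≤ (4m)^m e^{L/4}` and `c √L ≤ (1 + L)/8`). [folklore] -/
theorem sqrt_mul_log_pow_le_mul_exp {x c : ℝ} (hx : 1 ≤ x) (hc : c ≤ 1 / 8)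
    {m : ℕ} (hm : 1 ≤ m) :
    Real.sqrt x * Real.log x ^ m ≤
      (4 * m) ^ m * Real.exp (1 / 8) * (x * Real.exp (-c * Real.sqrt (Real.log x))) := by
  have hx0 : 0 < x := by linarith
  set L : ℝ := Real.log x with hLdef
  have hL : 0 ≤ L := Real.log_nonneg hx
  have hm0 : (0 : ℝ) < m := by exact_mod_cast hm
  have hxL : Real.exp L = x := Real.exp_log hx0
  -- `L^m ≤ (4m)^m e^{L/4}`
  have h1 : L ^ m ≤ (4 * m) ^ m * Real.exp (L / 4) := by
    have h := Real.add_one_le_exp (L / (4 * m))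
    have h' : L / (4 * m) ≤ Real.exp (L / (4 * m)) := by linarith
    have h'' : (L / (4 * m)) ^ m ≤ Real.exp (L / (4 * m)) ^ m :=
      pow_le_pow_left₀ (by positivity) h' m
    rw [← Real.exp_nat_mul, div_pow] at h''
    have h4m : (0 : ℝ) < (4 * m) ^ m := by positivity
    rw [div_le_iff₀ h4m] at h''
    calc L ^ m ≤ Real.exp (m * (L / (4 * m))) * (4 * m) ^ m := h''
      _ = (4 * m) ^ m * Real.exp (L / 4) := by
          rw [mul_comm]
          congr 1
          field_simp
  -- `√x = e^{L/2}`
  have h2 : Real.sqrt x = Real.exp (L / 2) := by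
    rw [hLdef, ← Real.log_sqrt hx0.le, Real.exp_log (Real.sqrt_pos.mpr hx0)]
  -- `e^{3L/4} ≤ e^{1/8} x e^{-c √L}`
  have hsqrtL : Real.sqrt L ≤ 1 + L := by
    rw [Real.sqrt_le_left (by linarith)]
    nlinarith
  have h3 : Real.exp (L / 2) * Real.exp (L / 4) ≤
      Real.exp (1 / 8) * (x * Real.exp (-c * Real.sqrt L)) := by
    rw [← hxL, ← Real.exp_add, ← Real.exp_add, ← Real.exp_add]
    refine Real.exp_le_exp.mpr ?_
    have : c * Real.sqrt L ≤ 1 / 8 * (1 + L) :=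
      (mul_le_mul_of_nonneg_right hc (Real.sqrt_nonneg _)).trans
        (mul_le_mul_of_nonneg_left hsqrtL (by norm_num))
    nlinarith
  calc Real.sqrt x * L ^ m ≤ Real.exp (L / 2) * ((4 * m) ^ m * Real.exp (L / 4)) := by
        rw [h2]
        exact mul_le_mul_of_nonneg_left h1 (Real.exp_nonneg _)
    _ = (4 * m) ^ m * (Real.exp (L / 2) * Real.exp (L / 4)) := by ring
    _ ≤ (4 * m) ^ m * (Real.exp (1 / 8) * (x * Real.exp (-c * Real.sqrt L))) :=
        mul_le_mul_of_nonneg_left h3 (by positivity)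
    _ = _ := by ring

/-- **`θ_K^{(1)}` from `ψ_K`**: if `|ψ_K(x) − x| ≤ C x e^{−c√log x}` (`x ≥ 2`, `c > 0`), then
`|θ_K^{(1)}(x) − x| ≤ C' x e^{−c'√log x}` for `x ≥ 2` with `c' = min c (1/8)`: the `θ_K`-form
(`chebyshevThetaIdeal_sub_self_le`, Landau 1903 §12) minus the prime ideals of degree `≥ 2`
(`chebyshevThetaIdeal_sub_degreeOneTheta_le`). [cite: LandauMathAnn1903, §§12–13 p. 669] -/
theorem abs_degreeOneTheta_sub_self_le_of_chebyshevPsi {c C : ℝ} (hc : 0 < c)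
    (hψ : ∀ x : ℝ, 2 ≤ x →
      |chebyshevPsiIdeal K x - x| ≤ C * x * Real.exp (-c * Real.sqrt (Real.log x))) :
    ∃ C' : ℝ, ∀ x : ℝ, 2 ≤ x →
      |degreeOneTheta K x - x| ≤ C' * x * Real.exp (-min c (1 / 8) * Real.sqrt (Real.log x)) := by
  set d : ℕ := Module.finrank ℚ K with hd
  set c' : ℝ := min c (1 / 8) with hc'
  set C₁ : ℝ := C + 4 * Real.exp (1 / 8) * ((1 + C) * (1 / Real.log 2 + 1 / Real.log 2 ^ 2))
    with hC₁
  set M : ℝ := (2 / Real.log 2) ^ (d + 1) * ((4 * (d + 2 : ℕ)) ^ (d + 2) * Real.exp (1 / 8))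
    with hM
  have hl2 : 0 < Real.log 2 := Real.log_pos one_lt_two
  have hc'0 : 0 < c' := lt_min hc (by norm_num)
  have hc'8 : c' ≤ 1 / 8 := min_le_right _ _
  refine ⟨C₁ + M, fun x hx => ?_⟩
  have hx1 : (1 : ℝ) ≤ x := by linarith
  have hx0 : (0 : ℝ) < x := by linarith
  set L : ℝ := Real.log x with hLdef
  set g : ℝ := Real.exp (-c' * Real.sqrt L) with hgdef
  have hLl : Real.log 2 ≤ L := Real.log_le_log two_pos hx
  have hL0 : 0 < L := hl2.trans_le hLl
  have hθ : |chebyshevThetaIdeal K x - x| ≤ C₁ * x * g :=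
    chebyshevThetaIdeal_sub_self_le hc hψ hx
  have hdiff := chebyshevThetaIdeal_sub_degreeOneTheta_le K hx1
  have hle := degreeOneTheta_le_chebyshevThetaIdeal K x
  -- `(L/log 2 + 1)^d (L/log 2) (2 √x L) ≤ (2/log 2)^{d+1} √x L^{d+2}`
  have hratio : 1 ≤ L / Real.log 2 := by rwa [le_div_iff₀ hl2, one_mul]
  have hB : (L / Real.log 2 + 1) ^ d * (L / Real.log 2) * (2 * Real.sqrt x * L) ≤
      (2 / Real.log 2) ^ (d + 1) * (Real.sqrt x * L ^ (d + 2)) := by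
    have h1 : (L / Real.log 2 + 1) ^ d ≤ (2 * (L / Real.log 2)) ^ d :=
      pow_le_pow_left₀ (by positivity) (by linarith) d
    calc (L / Real.log 2 + 1) ^ d * (L / Real.log 2) * (2 * Real.sqrt x * L)
        ≤ (2 * (L / Real.log 2)) ^ d * (L / Real.log 2) * (2 * Real.sqrt x * L) := by
          gcongr
      _ = (2 / Real.log 2) ^ (d + 1) * (Real.sqrt x * L ^ (d + 2)) := by
          have hl2ne : Real.log 2 ≠ 0 := hl2.ne'
          rw [mul_pow, div_pow, div_pow]
          field_simp
          ring
  have hkey : Real.sqrt x * L ^ (d + 2) ≤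
      (4 * (d + 2 : ℕ)) ^ (d + 2) * Real.exp (1 / 8) * (x * g) := by
    have := sqrt_mul_log_pow_le_mul_exp hx1 hc'8 (m := d + 2) (by omega)
    simpa [hgdef, hLdef] using this
  have hM0 : 0 ≤ (2 / Real.log 2) ^ (d + 1) := by positivity
  have hdiff' : chebyshevThetaIdeal K x - degreeOneTheta K x ≤ M * x * g := by
    calc chebyshevThetaIdeal K x - degreeOneTheta K x
        ≤ (L / Real.log 2 + 1) ^ d * (L / Real.log 2) * (2 * Real.sqrt x * L) := hdiff
      _ ≤ (2 / Real.log 2) ^ (d + 1) * (Real.sqrt x * L ^ (d + 2)) := hB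
      _ ≤ (2 / Real.log 2) ^ (d + 1) * ((4 * (d + 2 : ℕ)) ^ (d + 2) * Real.exp (1 / 8) * (x * g)) :=
          mul_le_mul_of_nonneg_left hkey hM0
      _ = M * x * g := by rw [hM]; ring
  have habs : |degreeOneTheta K x - x| ≤
      |chebyshevThetaIdeal K x - x| + (chebyshevThetaIdeal K x - degreeOneTheta K x) := by
    have h2 := abs_sub_le (degreeOneTheta K x) (chebyshevThetaIdeal K x) x
    have h1 : |degreeOneTheta K x - chebyshevThetaIdeal K x| =
        chebyshevThetaIdeal K x - degreeOneTheta K x := by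
      rw [abs_sub_comm]
      exact abs_of_nonneg (by linarith)
    linarith
  calc |degreeOneTheta K x - x|
      ≤ |chebyshevThetaIdeal K x - x| + (chebyshevThetaIdeal K x - degreeOneTheta K x) := habs
    _ ≤ C₁ * x * g + M * x * g := add_le_add hθ hdiff'
    _ = (C₁ + M) * x * g := by ring

end Literature.NumberTheory.LFunctions.NumberField

namespace Literature.NumberTheory.LFunctions.ThetaMertens

open Set
open scoped Topology

/-! ### Weight integrals -/

/-- `∫_2^x (1/(t log t) + 1/(t log² t)) dt = (log log x − 1/log x) − (log log 2 − 1/log 2)`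
for `x ≥ 2` (the derivative of `log log t − 1/log t`). [folklore] -/
theorem integral_Ioc_inv_div_log_add {x : ℝ} (hx : 2 ≤ x) :
    ∫ t in Ioc 2 x, (t⁻¹ / Real.log t + t⁻¹ / Real.log t ^ 2) =
      (Real.log (Real.log x) - (Real.log x)⁻¹) - (Real.log (Real.log 2) - (Real.log 2)⁻¹) := by
  have hderiv : ∀ t : ℝ, 1 < t → HasDerivAt (fun t => Real.log (Real.log t) - (Real.log t)⁻¹)
      (t⁻¹ / Real.log t + t⁻¹ / Real.log t ^ 2) t := by
    intro t ht
    have ht0 : t ≠ 0 := by linarith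
    have hl : Real.log t ≠ 0 := (Real.log_pos ht).ne'
    have h1 := (Real.hasDerivAt_log ht0).log hl
    have h2 := (Real.hasDerivAt_log ht0).inv hl
    refine (h1.sub h2).congr_deriv ?_
    field_simp
    ring
  have hcont : ContinuousOn (fun t : ℝ => t⁻¹ / Real.log t + t⁻¹ / Real.log t ^ 2) (Set.Icc 2 x) :=
    (Literature.NumberTheory.LFunctions.Mertens.continuousOn_inv_div_log x).add (Literature.NumberTheory.LFunctions.Mertens.continuousOn_inv_div_log_pow x 2)
  rw [← intervalIntegral.integral_of_le hx]
  refine intervalIntegral.integral_eq_sub_of_hasDerivAt (fun t ht => hderiv t ?_)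
    (hcont.mono ?_).intervalIntegrable
  · rw [Set.uIcc_of_le hx] at ht
    linarith [ht.1]
  · rw [Set.uIcc_of_le hx]

/-! ### Mertens-type asymptotics from Chebyshev-type asymptotics -/

/-- Auxiliary (proof-internal): the weighted Chebyshev function `t ↦ ∑_{p ≤ t} w(p) log p` is
measurable (it factors through `⌊t⌋₊`). [folklore] -/
theorem measurable_thetaWeight (w : ℕ → ℝ) :
    Measurable fun t : ℝ => ∑ p ∈ Nat.primesLE ⌊t⌋₊, w p * Real.log p := by
  have : (fun t : ℝ => ∑ p ∈ Nat.primesLE ⌊t⌋₊, w p * Real.log p) =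
      (fun n : ℕ => ∑ p ∈ Nat.primesLE n, w p * Real.log p) ∘ Nat.floor := by
    funext t; rfl
  rw [this]
  exact (measurable_from_nat (f := fun n : ℕ => ∑ p ∈ Nat.primesLE n, w p * Real.log p)).comp
    Nat.measurable_floor

/-- **Mertens' second theorem with rate, for weighted primes, from a Chebyshev estimate with
rate** (partial summation, Hardy–Wright §22.7 / Montgomery–Vaughan Thm 2.7(d)). Let `w : ℕ → ℝ`,
`λ ∈ ℝ`, `A ∈ ℕ` and suppose `|∑_{p ≤ t} w(p) log p − λ t| ≤ C t/(log t)^{A+1}` for all `t ≥ 2`.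
Then there are constants `c, K` with
`|∑_{p ≤ x} w(p)/p − (λ log log x + c)| ≤ K/(log x)^{A+1}` for all `x ≥ 2`.
(Abel summation with `f(t) = 1/(t log t)`: the main terms `λ/log x` cancel exactly, the error is
`E(x)/(x log x) − ∫_x^∞ E(t) (log t + 1) dt/(t² log² t)`.) [folklore] -/
theorem sum_primesLE_div_of_theta {w : ℕ → ℝ} {dens C : ℝ} {A : ℕ}
    (hθ : ∀ t : ℝ, 2 ≤ t →
      |∑ p ∈ Nat.primesLE ⌊t⌋₊, w p * Real.log p - dens * t| ≤ C * t / Real.log t ^ (A + 1)) :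
    ∃ c K : ℝ, ∀ x : ℝ, 2 ≤ x →
      |∑ p ∈ Nat.primesLE ⌊x⌋₊, w p / p - (dens * Real.log (Real.log x) + c)| ≤
        K / Real.log x ^ (A + 1) := by
  set θw : ℝ → ℝ := fun t => ∑ p ∈ Nat.primesLE ⌊t⌋₊, w p * Real.log p with hθw
  set E : ℝ → ℝ := fun t => θw t - dens * t with hE
  set φ : ℝ → ℝ := fun t => (Real.log t + 1) / (t ^ 2 * Real.log t ^ 2) with hφ
  have hl2 : 0 < Real.log 2 := Real.log_pos one_lt_two
  have hEb : ∀ t : ℝ, 2 ≤ t → |E t| ≤ C * t / Real.log t ^ (A + 1) := fun t ht => hθ t ht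
  have hC : 0 ≤ C := by
    have h := (abs_nonneg _).trans (hEb 2 le_rfl)
    have h2 : (0 : ℝ) < 2 / Real.log 2 ^ (A + 1) := by positivity
    have : C * 2 / Real.log 2 ^ (A + 1) = C * (2 / Real.log 2 ^ (A + 1)) := by ring
    rw [this] at h
    nlinarith
  -- the error integrand `φ E` is dominated by `C (1 + 1/log 2) / (t (log t)^{A+2})` on `[2, ∞)`
  set C₂ : ℝ := C * (1 + (Real.log 2)⁻¹) with hC₂
  have hdom : ∀ t : ℝ, 2 ≤ t → |φ t * E t| ≤ C₂ * (t⁻¹ / Real.log t ^ (A + 2)) := by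
    intro t ht
    have ht0 : 0 < t := by linarith
    have hlt : Real.log 2 ≤ Real.log t := Real.log_le_log two_pos ht
    have hl : 0 < Real.log t := hl2.trans_le hlt
    have hφ0 : 0 ≤ φ t := by simp only [hφ]; positivity
    rw [abs_mul, abs_of_nonneg hφ0]
    calc φ t * |E t| ≤ φ t * (C * t / Real.log t ^ (A + 1)) :=
          mul_le_mul_of_nonneg_left (hEb t ht) hφ0
      _ = C * (t⁻¹ / Real.log t ^ (A + 2)) * (1 + (Real.log t)⁻¹) := by
          simp only [hφ]
          field_simp
          ring
      _ ≤ C * (t⁻¹ / Real.log t ^ (A + 2)) * (1 + (Real.log 2)⁻¹) := by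
          refine mul_le_mul_of_nonneg_left ?_ (by positivity)
          gcongr
      _ = C₂ * (t⁻¹ / Real.log t ^ (A + 2)) := by rw [hC₂]; ring
  have hEmeas : Measurable E := (measurable_thetaWeight w).sub (measurable_id.const_mul dens)
  have hφmeas : Measurable φ :=
    ((Real.measurable_log.add_const 1).div ((measurable_id.pow_const 2).mul
      (Real.measurable_log.pow_const 2)))
  have hint : IntegrableOn (fun t => φ t * E t) (Ioi 2) := by
    refine Integrable.mono' ((Literature.NumberTheory.LFunctions.Mertens.integrableOn_inv_div_log_pow one_lt_two A).const_mul C₂)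
      (hφmeas.mul hEmeas).aestronglyMeasurable ?_
    rw [ae_restrict_iff' measurableSet_Ioi]
    exact Eventually.of_forall fun t ht => by
      rw [Real.norm_eq_abs]; exact hdom t (le_of_lt ht)
  set I : ℝ := ∫ t in Ioi 2, φ t * E t with hI
  set c : ℝ := w 2 / 2 - (2 * Real.log 2)⁻¹ * θw 2 +
    dens * ((Real.log 2)⁻¹ - Real.log (Real.log 2)) + I with hc
  set K : ℝ := C / Real.log 2 + C₂ / (A + 1) with hK
  refine ⟨c, K, fun x hx => ?_⟩
  have hx0 : 0 < x := by linarith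
  have hlx : 0 < Real.log x := Real.log_pos (by linarith)
  have hl2x : Real.log 2 ≤ Real.log x := Real.log_le_log two_pos hx
  /- Abel summation with `c_k = [k prime] w(k) log k`, `f(t) = 1/(t log t)` -/
  set cc : ℕ → ℝ := fun k => if k.Prime then w k * Real.log k else 0 with hcc
  set f : ℝ → ℝ := fun t => (t * Real.log t)⁻¹ with hf
  have hderiv : ∀ t : ℝ, 1 < t → HasDerivAt f (-φ t) t := by
    intro t ht
    have ht0 : t ≠ 0 := by linarith
    have hl : Real.log t ≠ 0 := (Real.log_pos ht).ne'
    have h1 : HasDerivAt (fun t : ℝ => t * Real.log t) (1 * Real.log t + t * t⁻¹) t :=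
      (hasDerivAt_id t).mul (Real.hasDerivAt_log ht0)
    refine (h1.inv (mul_ne_zero ht0 hl)).congr_deriv ?_
    simp only [hφ]
    field_simp
  have hf_diff : ∀ t ∈ Set.Icc 2 x, DifferentiableAt ℝ f t := fun t ht =>
    (hderiv t (by linarith [ht.1])).differentiableAt
  have hderiv_eq : Set.EqOn (fun t => -φ t) (deriv f) (Set.Icc 2 x) := fun t ht =>
    ((hderiv t (by linarith [ht.1])).deriv).symm
  have hφcont : ContinuousOn φ (Set.Icc 2 x) := by
    have hmem : ∀ t ∈ Set.Icc 2 x, t ∈ ({0}ᶜ : Set ℝ) := fun t ht =>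
      Set.mem_compl_singleton_iff.mpr (show (0 : ℝ) < t by linarith [ht.1]).ne'
    have hlogne : ∀ t ∈ Set.Icc 2 x, Real.log t ≠ 0 := fun t ht =>
      (Real.log_pos (by linarith [ht.1])).ne'
    refine ContinuousOn.div ((Real.continuousOn_log.mono hmem).add continuousOn_const)
      ((continuousOn_id.pow 2).mul ((Real.continuousOn_log.mono hmem).pow 2)) fun t ht => ?_
    exact mul_ne_zero (pow_ne_zero _ (by linarith [ht.1])) (pow_ne_zero _ (hlogne t ht))
  have hf_int : IntegrableOn (deriv f) (Set.Icc 2 x) :=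
    (hφcont.neg.integrableOn_Icc).congr_fun hderiv_eq measurableSet_Icc
  have habel := sum_mul_eq_sub_sub_integral_mul cc (by norm_num : (0 : ℝ) ≤ 2) hx hf_diff hf_int
  have hS : ∀ t : ℝ, ∑ k ∈ Icc 0 ⌊t⌋₊, cc k = θw t := fun t => by
    simp only [hθw, hcc]
    rw [Nat.primesLE_eq_filter_Icc_zero, sum_filter]
  have hfl2 : ⌊(2 : ℝ)⌋₊ = 2 := by norm_num
  have hfc : ∀ k : ℕ, f k * cc k = if k.Prime then w k / k else 0 := by
    intro k
    simp only [hf, hcc]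
    split_ifs with hk
    · have hk1 : (1 : ℝ) < k := by exact_mod_cast hk.one_lt
      have hk0 : (k : ℝ) ≠ 0 := by positivity
      have : Real.log k ≠ 0 := (Real.log_pos hk1).ne'
      field_simp
    · simp
  have hsum : ∀ n : ℕ, ∑ k ∈ Ioc 0 n, f k * cc k = ∑ p ∈ Nat.primesLE n, w p / p := by
    intro n
    rw [Nat.primesLE_eq_filter_Ioc_zero, Finset.sum_filter]
    exact Finset.sum_congr rfl fun k _ => hfc k
  have hx2 : 2 ≤ ⌊x⌋₊ := Nat.le_floor (by simpa using hx)
  have hlhs : ∑ k ∈ Ioc ⌊(2 : ℝ)⌋₊ ⌊x⌋₊, f k * cc k =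
      ∑ p ∈ Nat.primesLE ⌊x⌋₊, w p / p - w 2 / 2 := by
    rw [hfl2, ← hsum, eq_sub_iff_add_eq, add_comm,
      (Finset.sum_Ioc_consecutive _ (Nat.zero_le 2) hx2).symm]
    congr 1
    rw [show Finset.Ioc 0 2 = {1, 2} by decide, Finset.sum_pair (by norm_num), hfc, hfc]
    norm_num [Nat.prime_two, Nat.not_prime_one]
  have hb2 : f 2 * ∑ k ∈ Icc 0 ⌊(2 : ℝ)⌋₊, cc k = (2 * Real.log 2)⁻¹ * θw 2 := by
    rw [hS]
  have hbx : f x * ∑ k ∈ Icc 0 ⌊x⌋₊, cc k = dens / Real.log x + f x * E x := by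
    rw [hS, hE, hf]
    simp only
    field_simp
    ring
  -- the integral term
  have hIoc_int : IntegrableOn (fun t => φ t * E t) (Ioc 2 x) := hint.mono_set Ioc_subset_Ioi_self
  have hmain_int : IntegrableOn (fun t : ℝ => t⁻¹ / Real.log t + t⁻¹ / Real.log t ^ 2) (Ioc 2 x) :=
    ((Literature.NumberTheory.LFunctions.Mertens.continuousOn_inv_div_log x).add
      (Literature.NumberTheory.LFunctions.Mertens.continuousOn_inv_div_log_pow x 2)).integrableOn_Icc.mono_set Ioc_subset_Icc_self
  have hint_eq : ∫ t in Set.Ioc 2 x, deriv f t * ∑ k ∈ Icc 0 ⌊t⌋₊, cc k =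
      -(dens * ((Real.log (Real.log x) - (Real.log x)⁻¹) -
          (Real.log (Real.log 2) - (Real.log 2)⁻¹)) + ∫ t in Ioc 2 x, φ t * E t) := by
    have h1 : ∫ t in Set.Ioc 2 x, deriv f t * ∑ k ∈ Icc 0 ⌊t⌋₊, cc k =
        ∫ t in Set.Ioc 2 x, -(dens * (t⁻¹ / Real.log t + t⁻¹ / Real.log t ^ 2) + φ t * E t) := by
      refine setIntegral_congr_fun measurableSet_Ioc fun t ht => ?_
      rw [← hderiv_eq (Set.Ioc_subset_Icc_self ht), hS]
      have ht0 : (t : ℝ) ≠ 0 := by linarith [ht.1]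
      have hl : Real.log t ≠ 0 := (Real.log_pos (by linarith [ht.1])).ne'
      simp only [hE, hφ]
      field_simp
      ring
    rw [h1, integral_neg, integral_add (hmain_int.const_mul dens) hIoc_int,
      integral_const_mul, integral_Ioc_inv_div_log_add hx]
  -- splitting `∫_2^x φ E = I - ∫_x^∞ φ E`
  have hsplit : ∫ t in Ioc 2 x, φ t * E t = I - ∫ t in Ioi x, φ t * E t := by
    rw [hI, ← Set.Ioc_union_Ioi_eq_Ioi hx, setIntegral_union (Set.Ioc_disjoint_Ioi le_rfl)
      measurableSet_Ioi hIoc_int (hint.mono_set (Set.Ioi_subset_Ioi hx))]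
    ring
  -- the exact formula
  have hformula : ∑ p ∈ Nat.primesLE ⌊x⌋₊, w p / p - (dens * Real.log (Real.log x) + c) =
      f x * E x - ∫ t in Ioi x, φ t * E t := by
    rw [hlhs, hb2, hbx, hint_eq, hsplit] at habel
    rw [hc]
    linear_combination habel
  rw [hformula]
  -- bounds
  have h1 : |f x * E x| ≤ C / Real.log 2 / Real.log x ^ (A + 1) := by
    have hf0 : 0 ≤ f x := by simp only [hf]; positivity
    rw [abs_mul, abs_of_nonneg hf0]
    calc f x * |E x| ≤ f x * (C * x / Real.log x ^ (A + 1)) :=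
          mul_le_mul_of_nonneg_left (hEb x hx) hf0
      _ = C / Real.log x / Real.log x ^ (A + 1) := by
          simp only [hf]
          field_simp
      _ ≤ C / Real.log 2 / Real.log x ^ (A + 1) := by
          gcongr
  have h2 : |∫ t in Ioi x, φ t * E t| ≤ C₂ / (A + 1) / Real.log x ^ (A + 1) := by
    have hwint : IntegrableOn (fun t : ℝ => t⁻¹ / Real.log t ^ (A + 2)) (Ioi x) :=
      (Literature.NumberTheory.LFunctions.Mertens.integrableOn_inv_div_log_pow one_lt_two A).mono_set (Set.Ioi_subset_Ioi hx)
    have hbound : ∀ᵐ t ∂(volume.restrict (Ioi x)),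
        ‖φ t * E t‖ ≤ C₂ * (t⁻¹ / Real.log t ^ (A + 2)) := by
      rw [ae_restrict_iff' measurableSet_Ioi]
      refine Eventually.of_forall fun t ht => ?_
      rw [Real.norm_eq_abs]
      exact hdom t (hx.trans (le_of_lt ht))
    calc |∫ t in Ioi x, φ t * E t| = ‖∫ t in Ioi x, φ t * E t‖ := rfl
      _ ≤ ∫ t in Ioi x, C₂ * (t⁻¹ / Real.log t ^ (A + 2)) :=
          norm_integral_le_of_norm_le (hwint.const_mul C₂) hbound
      _ = C₂ * (((A : ℝ) + 1) * Real.log x ^ (A + 1))⁻¹ := by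
          rw [integral_const_mul, Literature.NumberTheory.LFunctions.Mertens.integral_Ioi_inv_div_log_pow (by linarith) A]
      _ = C₂ / (A + 1) / Real.log x ^ (A + 1) := by
          rw [mul_inv, div_div, div_eq_mul_inv, mul_inv]
  calc |f x * E x - ∫ t in Ioi x, φ t * E t|
      ≤ |f x * E x| + |∫ t in Ioi x, φ t * E t| := abs_sub _ _
    _ ≤ C / Real.log 2 / Real.log x ^ (A + 1) + C₂ / (A + 1) / Real.log x ^ (A + 1) :=
        add_le_add h1 h2
    _ = K / Real.log x ^ (A + 1) := by rw [hK]; ring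

end Literature.NumberTheory.LFunctions.ThetaMertens

namespace Literature.NumberTheory.LFunctions.NumberField

variable (K : Type*) [Field K] [NumberField K]

/-- **The prime number theorem for the degree-one primes of a number field** (Landau 1903, §13;
Montgomery–Vaughan Thm 8.9): for every number field `K` there are `c > 0` and `C` with
`|∑_{p ≤ x} c_K(p) log p − x| ≤ C x exp(−c √log x)` for all `x ≥ 2`, where
`c_K(p) = #{𝔭 : N𝔭 = p}`. PROVED: the tree's prime ideal theorem for `ψ_K`
(`abs_chebyshevPsiIdeal_sub_le`, from the Weber–Landau ideal count
`idealCount_sub_residue_mul_le_holds` through Landau's continuation of `ζ_K`), the passage to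
`θ_K`, and `abs_degreeOneTheta_sub_self_le_of_chebyshevPsi`.
[cite: LandauMathAnn1903, §§12-13 p. 669] -/
theorem abs_degreeOneTheta_sub_self_le :
    ∃ c : ℝ, 0 < c ∧ ∃ C : ℝ, ∀ x : ℝ, 2 ≤ x →
      |degreeOneTheta K x - x| ≤ C * x * Real.exp (-c * Real.sqrt (Real.log x)) := by
  obtain ⟨c, hc, C, hψ⟩ := abs_chebyshevPsiIdeal_sub_le K
    (exists_isLandauContinuation_of_idealCount K (idealCount_sub_residue_mul_le_holds K))
  obtain ⟨C', h⟩ := abs_degreeOneTheta_sub_self_le_of_chebyshevPsi K hc hψ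
  exact ⟨min c (1 / 8), lt_min hc (by norm_num), C', h⟩

/-- The same in the `(log x)^{-A}` currency: for every real `A` there is `C` with
`|∑_{p ≤ x} c_K(p) log p − x| ≤ C x/(log x)^A` for `x ≥ 2`. [folklore] -/
theorem abs_degreeOneTheta_sub_self_le_logPow (A : ℝ) :
    ∃ C : ℝ, ∀ x : ℝ, 2 ≤ x → |degreeOneTheta K x - x| ≤ C * x / Real.log x ^ A := by
  obtain ⟨c, hc, C, h⟩ := abs_degreeOneTheta_sub_self_le K
  refine logPow_of_expSqrt hc (C := C) (fun x hx => ?_) A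
  have := h x hx
  rwa [neg_mul, Real.exp_neg, ← div_eq_mul_inv] at this

/-- **Mertens' theorem for the degree-one primes, with rate**: for every number field `K` and
every `A ∈ ℕ` there are `c, C` with `|∑_{p ≤ x} c_K(p)/p − (log log x + c)| ≤ C/(log x)^{A+1}`
for all `x ≥ 2` (from `abs_degreeOneTheta_sub_self_le_logPow` by the partial summation
`Literature.NumberTheory.LFunctions.ThetaMertens.sum_primesLE_div_of_theta`; the constant `c` is the limit of
`DegreeOnePrimes.exists_tendsto_sum_primesLE_idealNormCount_sub_one_div` plus Mertens' `B₁`).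
[folklore] -/
theorem sum_primesLE_idealNormCount_div_eq (A : ℕ) :
    ∃ c C : ℝ, ∀ x : ℝ, 2 ≤ x →
      |∑ p ∈ Nat.primesLE ⌊x⌋₊, (idealNormCount K p : ℝ) / p - (Real.log (Real.log x) + c)| ≤
        C / Real.log x ^ (A + 1) := by
  obtain ⟨C, hC⟩ := abs_degreeOneTheta_sub_self_le_logPow K ((A + 1 : ℕ) : ℝ)
  have hθ : ∀ t : ℝ, 2 ≤ t → |∑ p ∈ Nat.primesLE ⌊t⌋₊, (idealNormCount K p : ℝ) * Real.log p -
      1 * t| ≤ C * t / Real.log t ^ (A + 1) := by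
    intro t ht
    have := hC t ht
    rw [Real.rpow_natCast] at this
    rw [one_mul]
    exact this
  obtain ⟨c, C', h⟩ := ThetaMertens.sum_primesLE_div_of_theta hθ
  exact ⟨c, C', fun x hx => by simpa only [one_mul] using h x hx⟩

end Literature.NumberTheory.LFunctions.NumberField

namespace Literature.NumberTheory.LFunctions.DegreeOnePrimes

open Polynomial

/-- **The prime number theorem for the roots of a polynomial congruence** (the Frobenius–Landau
density of the degree-one primes, quantitative form): for `g ∈ ℤ[X]` monic irreducible with
`ν_g(p) = #{n ∈ {0, …, p−1} : p ∣ g(n)}` there are `c > 0` and `C` with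
`|∑_{p ≤ x} ν_g(p) log p − x| ≤ C x exp(−c √log x)` for all `x ≥ 2`.
Proof: `ν_g(p) = c_K(p)` for `K = ℚ[X]/(g)` and all `p ∤ e`, `e ≠ 0` (Dedekind–Kummer,
`exists_card_absNorm_eq_prime_eq_rootCount`), so the sum differs from `θ_K^{(1)}(x)` of
`Literature.NumberTheory.LFunctions.NumberField.abs_degreeOneTheta_sub_self_le` by at most `∑_{p ∣ e} |ν_g(p) − c_K(p)| log p`,
and `x e^{−c√log x} ≥ e^{−c²/4}`. [cite: LandauMathAnn1903, §13 p. 669] -/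
theorem abs_sum_primesLE_rootCount_mul_log_sub_self_le {g : ℤ[X]} (hg : g.Monic)
    (hirr : Irreducible g) :
    ∃ c : ℝ, 0 < c ∧ ∃ C : ℝ, ∀ x : ℝ, 2 ≤ x →
      |∑ p ∈ Nat.primesLE ⌊x⌋₊,
          (#((range p).filter fun n : ℕ => (p : ℤ) ∣ g.eval (n : ℤ)) : ℝ) * Real.log p - x| ≤
        C * x * Real.exp (-c * Real.sqrt (Real.log x)) := by
  haveI : Fact (Irreducible (g.map (algebraMap ℤ ℚ))) := ⟨irreducible_map_rat hg hirr⟩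
  obtain ⟨e, he, hcount⟩ := exists_card_absNorm_eq_prime_eq_rootCount hg hirr
  obtain ⟨c, hc, C, hK⟩ :=
    NumberField.abs_degreeOneTheta_sub_self_le (AdjoinRoot (g.map (algebraMap ℤ ℚ)))
  set ν : ℕ → ℝ := fun p => (#((range p).filter fun n : ℕ => (p : ℤ) ∣ g.eval (n : ℤ)) : ℝ)
    with hν
  set δ : ℕ → ℝ := fun p =>
    (ν p - (idealNormCount (AdjoinRoot (g.map (algebraMap ℤ ℚ))) p : ℝ)) * Real.log p with hδ
  have hδ0 : ∀ p : ℕ, p.Prime → ¬ p ∣ e → δ p = 0 := by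
    intro p hp hpe
    simp only [hδ, hν]
    rw [idealNormCount_def, hcount p hp hpe, sub_self, zero_mul]
  set M : ℝ := ∑ p ∈ Nat.primesLE e, |δ p| with hM
  have hM0 : 0 ≤ M := sum_nonneg fun p _ => abs_nonneg _
  -- the two Chebyshev functions differ by at most `M`
  have hdiff : ∀ x : ℝ, |∑ p ∈ Nat.primesLE ⌊x⌋₊, ν p * Real.log p -
      NumberField.degreeOneTheta (AdjoinRoot (g.map (algebraMap ℤ ℚ))) x| ≤ M := by
    intro x
    rw [NumberField.degreeOneTheta, ← sum_sub_distrib]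
    have h1 : ∑ p ∈ Nat.primesLE ⌊x⌋₊, (ν p * Real.log p -
        (idealNormCount (AdjoinRoot (g.map (algebraMap ℤ ℚ))) p : ℝ) * Real.log p) =
        ∑ p ∈ (Nat.primesLE ⌊x⌋₊).filter (fun p => p ∣ e), δ p := by
      rw [sum_filter_of_ne]
      · exact sum_congr rfl fun p _ => by simp only [hδ]; ring
      · intro p hp hne
        by_contra hpe
        exact hne (by
          have := hδ0 p (Nat.mem_primesLE.mp hp).2 hpe
          simp only [hδ] at this
          linarith [this])
    rw [h1]
    calc |∑ p ∈ (Nat.primesLE ⌊x⌋₊).filter (fun p => p ∣ e), δ p|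
        ≤ ∑ p ∈ (Nat.primesLE ⌊x⌋₊).filter (fun p => p ∣ e), |δ p| := abs_sum_le_sum_abs _ _
      _ ≤ M := by
          refine sum_le_sum_of_subset_of_nonneg (fun p hp => ?_) fun p _ _ => abs_nonneg _
          obtain ⟨hp, hpe⟩ := mem_filter.mp hp
          exact Nat.mem_primesLE.mpr ⟨Nat.le_of_dvd he hpe, (Nat.mem_primesLE.mp hp).2⟩
  refine ⟨c, hc, C + M * Real.exp (c ^ 2 / 4), fun x hx => ?_⟩
  have hx0 : 0 < x := by linarith
  set L : ℝ := Real.log x with hL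
  have hL0 : 0 ≤ L := Real.log_nonneg (by linarith)
  -- `x e^{-c √L} ≥ e^{-c²/4}`
  have hlow : Real.exp (-(c ^ 2 / 4)) ≤ x * Real.exp (-c * Real.sqrt L) := by
    rw [← Real.exp_log hx0, ← Real.exp_add]
    refine Real.exp_le_exp.mpr ?_
    have hs : Real.sqrt L ^ 2 = L := Real.sq_sqrt hL0
    nlinarith [sq_nonneg (Real.sqrt L - c / 2)]
  have hMle : M ≤ M * Real.exp (c ^ 2 / 4) * (x * Real.exp (-c * Real.sqrt L)) := by
    calc M = M * Real.exp (c ^ 2 / 4) * Real.exp (-(c ^ 2 / 4)) := by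
          rw [mul_assoc, ← Real.exp_add, add_neg_cancel, Real.exp_zero, mul_one]
      _ ≤ M * Real.exp (c ^ 2 / 4) * (x * Real.exp (-c * Real.sqrt L)) :=
          mul_le_mul_of_nonneg_left hlow (by positivity)
  have h1 := hdiff x
  have h2 := hK x hx
  calc |∑ p ∈ Nat.primesLE ⌊x⌋₊, ν p * Real.log p - x|
      ≤ |∑ p ∈ Nat.primesLE ⌊x⌋₊, ν p * Real.log p -
          NumberField.degreeOneTheta (AdjoinRoot (g.map (algebraMap ℤ ℚ))) x| +
        |NumberField.degreeOneTheta (AdjoinRoot (g.map (algebraMap ℤ ℚ))) x - x| :=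
        abs_sub_le _ _ _
    _ ≤ M * Real.exp (c ^ 2 / 4) * (x * Real.exp (-c * Real.sqrt L)) +
        C * x * Real.exp (-c * Real.sqrt L) := add_le_add (h1.trans hMle) h2
    _ = (C + M * Real.exp (c ^ 2 / 4)) * x * Real.exp (-c * Real.sqrt L) := by ring

/-- The same in the `(log x)^{-A}` currency. [folklore] -/
theorem abs_sum_primesLE_rootCount_mul_log_sub_self_le_logPow {g : ℤ[X]} (hg : g.Monic)
    (hirr : Irreducible g) (A : ℝ) :
    ∃ C : ℝ, ∀ x : ℝ, 2 ≤ x →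
      |∑ p ∈ Nat.primesLE ⌊x⌋₊,
          (#((range p).filter fun n : ℕ => (p : ℤ) ∣ g.eval (n : ℤ)) : ℝ) * Real.log p - x| ≤
        C * x / Real.log x ^ A := by
  obtain ⟨c, hc, C, h⟩ := abs_sum_primesLE_rootCount_mul_log_sub_self_le hg hirr
  refine logPow_of_expSqrt hc (C := C) (fun x hx => ?_) A
  have := h x hx
  rwa [neg_mul, Real.exp_neg, ← div_eq_mul_inv] at this

/-- **Mertens' theorem for the roots of a polynomial congruence, with rate**: for `g ∈ ℤ[X]`
monic irreducible and `A ∈ ℕ` there are `c, C` with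
`|∑_{p ≤ x} ν_g(p)/p − (log log x + c)| ≤ C/(log x)^{A+1}` for all `x ≥ 2`. (The limit form,
without rate and without the prime ideal theorem, is
`exists_tendsto_sum_primesLE_rootCount_sub_one_div`.) [folklore] -/
theorem sum_primesLE_rootCount_div_eq {g : ℤ[X]} (hg : g.Monic) (hirr : Irreducible g) (A : ℕ) :
    ∃ c C : ℝ, ∀ x : ℝ, 2 ≤ x →
      |∑ p ∈ Nat.primesLE ⌊x⌋₊,
          (#((range p).filter fun n : ℕ => (p : ℤ) ∣ g.eval (n : ℤ)) : ℝ) / p -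
            (Real.log (Real.log x) + c)| ≤ C / Real.log x ^ (A + 1) := by
  obtain ⟨C, hC⟩ := abs_sum_primesLE_rootCount_mul_log_sub_self_le_logPow hg hirr ((A + 1 : ℕ) : ℝ)
  have hθ : ∀ t : ℝ, 2 ≤ t → |∑ p ∈ Nat.primesLE ⌊t⌋₊,
      (#((range p).filter fun n : ℕ => (p : ℤ) ∣ g.eval (n : ℤ)) : ℝ) * Real.log p - 1 * t| ≤
        C * t / Real.log t ^ (A + 1) := by
    intro t ht
    have := hC t ht
    rw [Real.rpow_natCast] at this
    rw [one_mul]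
    exact this
  obtain ⟨c, C', h⟩ := ThetaMertens.sum_primesLE_div_of_theta hθ
  exact ⟨c, C', fun x hx => by simpa only [one_mul] using h x hx⟩

end Literature.NumberTheory.LFunctions.DegreeOnePrimes

end
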